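import Summits.BirchSwinnertonDyer.BirchSwinnertonDyer.Theorems.CumulativeHeegnerLeopoldtCumulativeHeegnerInclusionAtThreeResidualDevissage
import Summits.BirchSwinnertonDyer.BirchSwinnertonDyer.Theorems.CumulativeHeegnerLeopoldtCumulativeHeegnerInclusionAtThreeLineBaseChange
import Summits.BirchSwinnertonDyer.BirchSwinnertonDyer.Theorems.CumulativeHeegnerLeopoldtCumulativeHeegnerInclusionAtThreeTowerFixed
import Summits.BirchSwinnertonDyer.BirchSwinnertonDyer.Theorems.CumulativeHeegnerLeopoldtCumulativeHeegnerInclusionAtThreeStubResidualSelmerFiniteLineDeterminant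
import Summits.BirchSwinnertonDyer.BirchSwinnertonDyer.Theorems.CumulativeHeegnerLeopoldtCumulativeHeegnerInclusionAtThreeBadPlacesSplitFinite
import Summits.BirchSwinnertonDyer.BirchSwinnertonDyer.Theorems.UniversalToricDescentAcDualMuZeroCriterion
import Summits.BirchSwinnertonDyer.Rank1Residual.X2.TateLineDecomposition
import Literature.NumberTheory.EllipticCurves.TateCurve.NumberFieldUniformizationTwisted
import Literature.NumberTheory.EllipticCurves.CastellaGrossiLeeSkinner2022.ResidualCharacterSelmerFinite
import Literature.NumberTheory.EllipticCurves.KellerYin2024.MultiplicativeImprimitiveMuInvariant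
import Literature.NumberTheory.EllipticCurves.Rank1Residual.GVParityTwistProofs
import Literature.NumberTheory.EllipticCurves.AnticyclotomicPrimeDecompositionAboveProofs
import Literature.NumberTheory.EllipticCurves.CanonicalPAdicHeightRestrictionProofs
import Literature.NumberTheory.GaloisRepresentations.IntegralGaloisActionProofs
import HarnessLib

/-!
# Keller–Yin Lemma 5.1.1 at a NON-SPLIT multiplicative Eisenstein prime, FROM PRINT:
# `CastellaGrossiLeeSkinner2022.prop14_residualCharacterSelmer_finite` (CGLS22 Prop. 14 = Rubin 1991 +
# Hida 2010) ⟹ `Sel_v̄^{Sf}(K_∞, E_K[p^∞])[p]` finite ⟹ `X^{Sf}` is `Λ`-torsion with `μ = 0`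
# (cell `bsd-eis`, seat `bsd-line-x2-p2` gen 4, D-0154 KEY row 5; crux 4 `BSDpOnCellC` line b1 v12, stub
# `stub_lemma511`; companions p621903, p624583)

HONEST FRAMING (cell `bsd-eis`, run/shared/lean/pub/bsd-eis/): tool theorems (no definition, no new named
fact, no `sorry`); every theorem with `prop14_…` in a hypothesis is CONDITIONAL on that PUBLISHED named fact
(Castella–Grossi–Lee–Skinner, Invent. Math. 227 (2022) §1.2 Prop. 14; printed proof Rubin 1991 + Hida 2010);
nothing about any particular curve is asserted; nothing booked; no label or count moves; BSD and the main
conjectures are proved for NO curve. Helper `--supports stmt-BirchSwinnertonDyer-19034`; it closes no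
registered stub (the SPLIT half of `stub_lemma511` stays a preprint claim, see "What this is NOT").

## Why

v12's `stub_lemma511` is the NAMED preprint fact
`KellerYin2024.lemma511_imprimitive_isTorsion_muInvariant_eq_zero_mult_OPEN` (Keller–Yin arXiv:2402.12781v2
§5.1 Lemma 5.1.1): at an odd Eisenstein `p ‖ N`, `X^{Sf} = AcSelmer.XAc (E_K) p κ v̄ ↑Sf γ` is `Λ`-torsion
with `μ = 0`. Its printed proof is "essentially Thm. 1.4.1, since the proof only relies on the extension
`0 → 𝔽(φ) → ρ̄_f → 𝔽(ψ) → 0`" — i.e. the Castella–Grossi–Lee–Skinner residual devissage (CGLS §1 Props.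
17–18) fed by the finiteness of the residual Selmer groups of the two CHARACTERS (CGLS Prop. 14, Rubin +
Hida), whose printed hypothesis is `θ|_{G_v̄} ∉ {1, ω}`. At a NON-SPLIT multiplicative prime the
Jordan–Hölder characters of `E[p]|_{G_p}` are `ωδ, δ` with `δ` the non-trivial unramified quadratic
character (Tate–Silverman *ATAEC* V.5.3), so BOTH characters satisfy CGLS's hypothesis: this is the tree's
`X2.TateLineDecomposition.not_fix_and_not_quot_of_not_split` (on the PROVED twisted Tate uniformisation
`TateCurve.Silverman1994_thmV53_corV54_tateUniformisation_holds`). At a SPLIT multiplicative prime they are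
`{1, ω}` (`X2.TateLineDecomposition.fix_or_quot_of_split`) and CGLS Prop. 14 does not apply (the anomalous
case; Keller–Yin §1 is the only text) — that half is NOT touched here.

This file ports the route-`CumulativeHeegnerLeopoldt` chain "stub B1 from print" (seats chl-k1-p1 / -w2:
`…ResidualDevissage` CGLS Prop. 17 + Lim–Sujatha, `…LineBaseChange` degree-one transport,
`…TowerFixed`, `…LineDeterminant` `φψ = ω`, `…BadPlacesSplitFinite`; all general in `p`) from
(`p = 3`, Leopoldt cell, non-anomalous clause ASSUMED) to (odd `p ‖ N` NON-SPLIT, `Sf`-imprimitive,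
non-anomalous clause PROVED):

* §1 `not_fix_and_not_quot_of_not_split_of_mem_primesAbove` — at EVERY prime `𝔓` of `\bar ℤ` above a
  non-split multiplicative odd `p`, `D_𝔓` neither fixes a rational line `Φ ≤ E[p]` pointwise nor acts
  trivially on `E[p]/Φ` (the chosen-prime statement of `X2.TateLineDecomposition`, moved to all `𝔓 ∣ p`
  by the transitivity of `Γ_ℚ` on the primes above `p` and `D_{σ𝔓} = σ D_𝔓 σ⁻¹`).
* §2 **`residualFinite_of_prop14_of_not_split`** — CGLS Prop. 14 ⟹ `{s ∈ Sel_v̄^{Sf}(K_∞, E_K[p^∞]) :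
  p s = 0}` finite, at the binders of the named fact plus `¬ split` (`2 < p`, `Mult`, `Red`, `K`
  imaginary quadratic Heegner for `N_E`, `(p)` split, `v̄ ∋ p`, `κ` anticyclotomic, `Sf` = places over
  `N_E` off `p`; `d_K` odd / `≠ −3` and `γ` are not needed).
* §3 **`isTorsion_muInvariant_eq_zero_of_prop14_of_not_split`** — the same ⟹ `X^{Sf}` is `Λ`-torsion with
  `μ(X^{Sf}) = 0` (Greenberg's criterion (A), tree `UniversalToricDescentAcDualMuZero.*`), i.e. the
  conclusion of the named fact VERBATIM at every non-split datum; and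
  `lemma511Nonsplit_of_prop14` — the named fact's statement with the extra binder
  `¬ W.HasSplitMultiplicativeReductionAtPrime p`, from CGLS Prop. 14.

What this is NOT: not a proof of CGLS Prop. 14 (Rubin's main conjecture + Hida's `μ = 0`); not the split
half (characters `{1, ω}` locally — no printed statement); not a change to the skeleton of record (v12).

References: [CastellaGrossiLeeSkinner2022] §1.2 Def. 10, Thm. 11, Prop. 14, §1.4 Props. 17–18
(arXiv:2008.02571; Invent. Math. 227 (2022) 517–580); [KellerYin2024] Lemma 5.1.1 (arXiv:2402.12781v2 §5.1
TeX L1744–1749), Thm. 1.4.1; [GreenbergVatsal2000] §2 pp. 14–15, Prop. (2.8); [SilvermanATAEC1994] V.5.2 (c),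
V.5.3, V.5.4; [Brink2007] Cor. 1; [NeukirchANT1999] I §9 (9.1), (9.4)–(9.6); [LimSujatha2018] §3;
[GreenbergLNM1716] §1 p. 60; [Castella2018] Def. 2.2; cell: p613183, p609974, p611257, p611775, p614784,
p613929 (chl-k1), p621903, p624583 (this seat's lineage).
-/

set_option autoImplicit false
set_option linter.dupNamespace false -- the summit namespace `…BirchSwinnertonDyer.BirchSwinnertonDyer.Theorems` (Sub = Summit, D-0017) trips it

noncomputable section

open scoped Classical Pointwise

open WeierstrassCurve NumberField IsDedekindDomain Field
  Literature.NumberTheory.EllipticCurves Literature.NumberTheory.EllipticCurves.IwasawaAlgebra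
  Literature.NumberTheory.EllipticCurves.GreenbergSelmer
  Literature.NumberTheory.EllipticCurves.GreenbergVatsal2000
  Literature.NumberTheory.GaloisRepresentations IsDedekindDomain.HeightOneSpectrum
  Literature.NumberTheory.EllipticCurves.Rank1Residual
  Summit.BirchSwinnertonDyer.Rank1Residual.X11b Summit.BirchSwinnertonDyer.Rank1Residual.X11b.AcSelmer
  Summit.BirchSwinnertonDyer.Rank1Residual.X2.ResidualDevissageModules
  Summit.BirchSwinnertonDyer.BirchSwinnertonDyer.Theorems
  Summit.BirchSwinnertonDyer.BirchSwinnertonDyer.Theorems.CumulativeHeegnerInclusionAtThreeResidualDevissage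
  Summit.BirchSwinnertonDyer.BirchSwinnertonDyer.Theorems.CumulativeHeegnerInclusionAtThreeLineBaseChange
  Summit.BirchSwinnertonDyer.BirchSwinnertonDyer.Theorems.CumulativeHeegnerInclusionAtThreeTowerFixed
  Summit.BirchSwinnertonDyer.BirchSwinnertonDyer.Theorems.CumulativeHeegnerInclusionAtThreeStubB1LineDeterminant
  Summit.BirchSwinnertonDyer.BirchSwinnertonDyer.Theorems.CumulativeHeegnerInclusionAtThreeBadPlaces
  Summit.BirchSwinnertonDyer.BirchSwinnertonDyer.Theorems.AdditiveKoly.SplitCompletion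
open Literature.NumberTheory.EllipticCurves.KellerYin2024
  (lemma511_imprimitive_isTorsion_muInvariant_eq_zero_mult_OPEN)
open Literature.NumberTheory.EllipticCurves.CastellaGrossiLeeSkinner2022 (prop14_residualCharacterSelmer_finite)

namespace Summit.BirchSwinnertonDyer.BirchSwinnertonDyer.Theorems.KellerYinLemma511NonsplitOfPrint

/-! ### §1 The non-anomalous clause at EVERY prime above a non-split multiplicative odd `p` -/

/-- **At a NON-SPLIT multiplicative odd prime `p`, for every prime `𝔓` of `\bar ℤ` above `p` and every
rational line `Φ ≤ E[p]`: the decomposition group `D_𝔓 ≤ Γ_ℚ` does NOT fix `Φ` pointwise and does NOT act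
trivially on `E[p]/Φ`** (`φ|_{G_p} ≠ 1` and `ψ|_{G_p} ≠ 1`; with `φψ = ω` also `≠ ω`). For the prime `𝔓₀`
cut out by the chosen embedding `ℚ̄ → \bar ℚ_p` (`D_{𝔓₀} = GreenbergSelmer.decomp v`) this is the tree's
`X2.TateLineDecomposition.not_fix_and_not_quot_of_not_split` (Jordan–Hölder characters `ωδ, δ` of the twisted
Tate module, `δ(Frob) = −1`; twisted Tate uniformisation PROVED,
`TateCurve.Silverman1994_thmV53_corV54_tateUniformisation_holds`); a general `𝔓 = σ 𝔓₀` (transitivity,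
`exists_smul_eq_of_mem_primesAbove_holds`) has `D_𝔓 = σ D_{𝔓₀} σ⁻¹`, and both clauses are invariant under
conjugation because `Φ` is `Γ_ℚ`-stable.
[cite: GreenbergVatsal2000, §2 pp. 14–15] [cite: SilvermanATAEC1994, Ch. V Lemma 5.2 (c), Thm. 5.3, Cor. 5.4]
[cite: NeukirchANT1999, Ch. I §9 Prop. (9.1) and remark after (9.5)] -/
theorem not_fix_and_not_quot_of_not_split_of_mem_primesAbove
    (W : WeierstrassCurve ℚ) [W.IsElliptic] [W.IsGloballyMinimal] (p : ℕ) [Fact p.Prime]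
    (hp2 : p ≠ 2) (hmult : W.HasMultiplicativeReductionAtPrime p)
    (hns : ¬ W.HasSplitMultiplicativeReductionAtPrime p)
    {v : HeightOneSpectrum (𝓞 ℚ)} (hpv : ((p : ℕ) : 𝓞 ℚ) ∈ v.asIdeal)
    {Φ : AddSubgroup (geomTorsion W (p : ℤ))} (hΦ : IsRationalLine W p Φ)
    {𝔓 : Ideal (absIntegers (𝓞 ℚ) ℚ)} (h𝔓 : 𝔓 ∈ v.primesAbove) :
    (¬ ∀ g ∈ 𝔓.decompositionSubgroup (absoluteGaloisGroup ℚ), ∀ P ∈ Φ, g • P = P) ∧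
      (¬ ∀ g ∈ 𝔓.decompositionSubgroup (absoluteGaloisGroup ℚ),
        ∀ P : geomTorsion W (p : ℤ), g • P - P ∈ Φ) := by
  obtain ⟨h1, h2⟩ :=
    Summit.BirchSwinnertonDyer.Rank1Residual.X2.TateLineDecomposition.not_fix_and_not_quot_of_not_split W p
    TateCurve.Silverman1994_thmV53_corV54_tateUniformisation_holds hp2 hmult hns hpv hΦ.1
  -- `𝔓 = σ • 𝔓₀` with `𝔓₀` the chosen prime above `v`, `D_{𝔓₀} = decomp v`
  obtain ⟨σ, hσ⟩ := IsDedekindDomain.HeightOneSpectrum.exists_smul_eq_of_mem_primesAbove_holds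
    (adicCompletionPrime_mem_primesAbove ℚ v) h𝔓
  have hconj : ∀ g ∈ decomp (K := ℚ) v,
      σ * g * σ⁻¹ ∈ 𝔓.decompositionSubgroup (absoluteGaloisGroup ℚ) := by
    intro g hg
    have hg' : g ∈ (adicCompletionPrime ℚ v).decompositionSubgroup (absoluteGaloisGroup ℚ) := by
      rw [decompositionSubgroup_adicCompletionPrime_eq_range]; exact hg
    rw [← hσ, Ideal.decompositionSubgroup_smul]
    have := Subgroup.smul_mem_pointwise_smul g (MulAut.conj σ) _ hg'
    simpa only [MulAut.smul_def, MulAut.conj_apply] using this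
  refine ⟨fun h ↦ h1 fun g hg P hP ↦ ?_, fun h ↦ h2 fun g hg P ↦ ?_⟩
  · -- `(σ g σ⁻¹) • (σ • P) = σ • P` for `P ∈ Φ`, i.e. `σ • (g • P) = σ • P`
    have hσP : σ • P ∈ Φ := hΦ.2 σ P hP
    have h' := h _ (hconj g hg) (σ • P) hσP
    rw [mul_smul, mul_smul, inv_smul_smul] at h'
    simpa only [inv_smul_smul] using congrArg (σ⁻¹ • ·) h'
  · -- `(σ g σ⁻¹) • (σ • P) - σ • P = σ • (g • P - P) ∈ Φ`
    have h' := h _ (hconj g hg) (σ • P)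
    rw [mul_smul, mul_smul, inv_smul_smul, ← smul_sub] at h'
    simpa only [inv_smul_smul] using hΦ.2 σ⁻¹ _ h'

/-! ### §2 CGLS Prop. 14 ⟹ residual finiteness at a non-split multiplicative Eisenstein datum -/

/-- **CGLS22 Prop. 14 ⟹ `Sel_v̄^{Sf}(K_∞, E_K[p^∞])[p]` finite, at every NON-SPLIT multiplicative Eisenstein
datum.** Binders: `W/ℚ` globally minimal, `2 < p`, `p ‖ N` NON-SPLIT, `E[p]` reducible; `K` imaginary
quadratic with the Heegner hypothesis for `N_E` and `(p)` split; `v̄ ∋ p` (the strict prime); `κ` the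
anticyclotomic `ℤ_p`-extension; `Sf` = the places of `K` over `N_E` not over `p`. Proof (the CGLS §1 road,
reduction-type-free pieces from route `CumulativeHeegnerLeopoldt`): a rational line `Φ`
(`exists_isRationalLine_of_not_irr`); §1 at the primes above `p`; base change of `Φ` to a `Γ_K`-stable
`S ≤ E_K[p]` and degree-one transport of the two clauses to `D_{v̄}` (`…LineBaseChange`, `e = f = 1` as `(p)`
splits); no `G_{K_{∞,v̄}}`-fixed vector in `E_K[p]/S` (`…TowerFixed`); CGLS's «`θ|_D ≠ ω`» for both characters
from `φψ = ω` (`…LineDeterminant`); `Sf` is finite, prime to `p`, over rational primes split in `K` (Heegner), and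
`E_K[p]`, `S`, `E_K[p]/S` are unramified at the places `∉ Sf` prime to `p` (good reduction there: a bad place of
`E_K` lies over `ℓ ∣ N_E`); Prop. 14 (hypothesis `hfact`) for `M = S` and `M = E_K[p]/S`; the devissage + Kummer
step `finite_selmerAc_pTorsion_of_line_devissage` with Brink's `D_{v̄} ⊄ ker κ`. CONDITIONAL on the published
named fact `hfact`; nothing else assumed.
[cite: CastellaGrossiLeeSkinner2022, §1.2 Prop. 14, §1.4 Props. 17–18 (arXiv:2008.02571; Invent. Math. 227 (2022))]
[cite: KellerYin2024, Lemma 5.1.1 (arXiv:2402.12781v2 §5.1 TeX L1744–1749)]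
[cite: SilvermanATAEC1994, Ch. V Thm. 5.3, Cor. 5.4] [cite: Brink2007, Cor. 1] -/
theorem residualFinite_of_prop14_of_not_split
    (hfact : prop14_residualCharacterSelmer_finite)
    {p : ℕ} [hp : Fact p.Prime] (W : WeierstrassCurve ℚ) [W.IsElliptic] [W.IsGloballyMinimal]
    (K : Type) [Field K] [NumberField K] (vbar : HeightOneSpectrum (𝓞 K))
    (κ : ZpExtension K p) (Sf : Finset (HeightOneSpectrum (𝓞 K)))
    (hp2 : 2 < p) (hmult : Mult W p) (hns : ¬ W.HasSplitMultiplicativeReductionAtPrime p)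
    (hred : Red W p) (hK : IsImaginaryQuadratic K)
    (hH : SatisfiesHeegnerHypothesis (W.conductorNorm ℤ) K)
    (hsplit : ((Ideal.span {(p : ℤ)}).primesOver (𝓞 K)).ncard = 2)
    (hvbar : ((p : ℕ) : 𝓞 K) ∈ vbar.asIdeal) (hκ : κ.IsAnticyclotomic)
    (hSf : ∀ w : HeightOneSpectrum (𝓞 K), w ∈ Sf ↔
      (((W.conductorNorm ℤ : ℤ) : 𝓞 K) ∈ w.asIdeal ∧ ((p : ℕ) : 𝓞 K) ∉ w.asIdeal)) :
    Set.Finite {s : selmerAc (W.baseChange K) p κ vbar (↑Sf : Set (HeightOneSpectrum (𝓞 K))) |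
      p • s = 0} := by
  have hpp : p.Prime := hp.out
  have hp2' : p ≠ 2 := by omega
  haveI hEK : (W.baseChange K).IsElliptic := inferInstanceAs (W.map (algebraMap ℚ K)).IsElliptic
  haveI : IsGalois ℚ K := isGalois_of_finrank_eq_two K hK.1
  /- `(p)` splits: `e(v̄|p) = f(v̄|p) = 1` -/
  have he : vbar.asIdeal.ramificationIdx (𝓞 ℚ) = 1 :=
    ramificationIdx_eq_one_of_card_primesOver K p hK.1 hsplit vbar hvbar
  have hf : vbar.asIdeal.inertiaDeg (𝓞 ℚ) = 1 :=
    inertiaDeg_eq_one_of_card_primesOver K p hK.1 hsplit vbar hvbar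
  set v : HeightOneSpectrum (𝓞 ℚ) := vbar.under (𝓞 ℚ) with hv
  have hw : vbar.asIdeal.under (𝓞 ℚ) = v.asIdeal := by rw [hv, HeightOneSpectrum.under_asIdeal]
  have hpv : ((p : ℕ) : 𝓞 ℚ) ∈ v.asIdeal := natCast_mem_under K p vbar hvbar
  /- a rational line and the non-anomalous clause at every prime above `p` (§1) -/
  obtain ⟨Φ, hΦ⟩ := exists_isRationalLine_of_not_irr W p hred
  have hcell : ∀ 𝔓 ∈ v.primesAbove,
      (¬ ∀ g ∈ 𝔓.decompositionSubgroup (absoluteGaloisGroup ℚ), ∀ P ∈ Φ, g • P = P) ∧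
        (¬ ∀ g ∈ 𝔓.decompositionSubgroup (absoluteGaloisGroup ℚ),
          ∀ P : geomTorsion W (p : ℤ), g • P - P ∈ Φ) :=
    fun 𝔓 h𝔓 ↦ not_fix_and_not_quot_of_not_split_of_mem_primesAbove W p hp2' hmult hns hpv hΦ h𝔓
  /- the line over `K` -/
  obtain ⟨t, ht⟩ := exists_geomTorsion_baseChange_equiv W K ((p : ℕ) : ℤ)
  have ht' : ∀ (σ : absoluteGaloisGroup K) (P : W.geomTorsion ((p : ℕ) : ℤ)),
      t (absGaloisRestrict ℚ K σ • P) = σ • t P := fun σ P ↦ by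
    rw [← resGal_eq_absGaloisRestrict]; exact ht σ P
  obtain ⟨S, hS, hcardS⟩ := exists_stableSubgroup_corr Φ t ht' hΦ.2
  have hSub : Nat.card S.Sub = p := by rw [hcardS, hΦ.1]
  have hEp : Nat.card ((W.baseChange K).geomTorsion ((p : ℕ) : ℤ)) = p ^ 2 :=
    (W.baseChange K).natCard_geomTorsion_prime_eq_sq hpp
  have hQuot : Nat.card S.Quot = p := by
    have h := S.natCard_eq_mul
    rw [hEp, hSub, sq] at h
    exact (Nat.eq_of_mul_eq_mul_right hpp.pos h).symm
  /- the non-anomalous clause on `decomp v̄` -/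
  have hnon1 : ¬ ∀ γ ∈ decomp vbar, ∀ x : S.Sub, γ • x = x :=
    not_forall_decomp_smul_sub_eq_of_corr Φ t ht' S hS
      (not_forall_decomp_smul_eq K Φ hw he hf fun 𝔓 h𝔓 ↦ (hcell 𝔓 h𝔓).1)
  have hnon2 : ¬ ∀ γ ∈ decomp vbar, ∀ y : S.Quot, γ • y = y :=
    not_forall_decomp_smul_quot_eq_of_corr Φ t ht' S hS
      (not_forall_decomp_smul_sub_mem K Φ hw he hf fun 𝔓 h𝔓 ↦ (hcell 𝔓 h𝔓).2)
  /- no `ker κ ⊓ D_{v̄}`-fixed vector in the quotient -/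
  have hfix : ∀ y : S.Quot, (∀ g : ↥(κ.kerSubgroup ⊓ decomp vbar), g • y = y) → y = 0 :=
    eq_zero_of_fixed_of_not_forall_decomp_smul_eq κ vbar hQuot hnon2
  /- CGLS's `θ|D ≠ ω` for both characters, from `φψ = ω` -/
  have hωS : ¬ ∀ g ∈ decomp vbar, ∀ m : S.Sub,
      g • m = ((modNCyclotomicCharacter K p g : (ZMod p)ˣ) : ZMod p).val • m :=
    not_forall_smul_sub_eq_cyclotomic (W.baseChange K) p S hSub (decomp vbar) hnon2
  have hωQ : ¬ ∀ g ∈ decomp vbar, ∀ m : S.Quot,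
      g • m = ((modNCyclotomicCharacter K p g : (ZMod p)ˣ) : ZMod p).val • m :=
    not_forall_smul_quot_eq_cyclotomic (W.baseChange K) p S hSub (decomp vbar) hnon1
  /- the imprimitivity set `Sf`: finite, prime to `p`, over split rational primes; good reduction off it -/
  set S₀ : Set (HeightOneSpectrum (𝓞 K)) := (↑Sf : Set (HeightOneSpectrum (𝓞 K))) with hS₀
  have hS₀fin : S₀.Finite := Sf.finite_toSet
  have hgood : ∀ w : HeightOneSpectrum (𝓞 K), w ∉ S₀ → ((p : ℕ) : 𝓞 K) ∉ w.asIdeal →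
      (W.baseChange K).HasGoodReductionAt w := fun w hw hpw ↦ by
    by_contra hbad
    obtain ⟨ℓ, -, hℓw, hℓN⟩ := exists_prime_mem_dvd_conductorNorm_of_not_hasGoodReductionAt W K w hbad
    apply hw
    rw [hS₀, Finset.mem_coe, hSf]
    refine ⟨?_, hpw⟩
    obtain ⟨m, hm⟩ := hℓN
    rw [hm, Nat.cast_mul, Int.cast_mul, Int.cast_natCast]
    exact w.asIdeal.mul_mem_right _ hℓw
  have hS₀mem : ∀ w ∈ S₀, ((p : ℕ) : 𝓞 K) ∉ w.asIdeal ∧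
      ((w.asIdeal.under ℤ).primesOver (𝓞 K)).ncard = 2 := fun w hw ↦ by
    rw [hS₀, Finset.mem_coe, hSf] at hw
    refine ⟨hw.2, ?_⟩
    obtain ⟨ℓ, hℓ, hℓw⟩ := exists_prime_natCast_mem_asIdeal w
    haveI : Fact ℓ.Prime := ⟨hℓ⟩
    have hunder : w.asIdeal.under ℤ = Ideal.span {(ℓ : ℤ)} :=
      (liesOver_span_int K ℓ w (by exact_mod_cast hℓw)).over.symm
    have hℓN : ℓ ∣ W.conductorNorm ℤ := by
      have hmem : ((W.conductorNorm ℤ : ℕ) : ℤ) ∈ w.asIdeal.under ℤ := by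
        rw [Ideal.under_def, Ideal.mem_comap, map_natCast]
        have := hw.1
        rwa [Int.cast_natCast] at this
      rw [hunder, Ideal.mem_span_singleton] at hmem
      exact_mod_cast hmem
    rw [hunder]
    exact hH ℓ hℓ hℓN
  /- unramified outside `S₀ ∪ {w ∣ p}` -/
  have hM : ∀ m : (W.baseChange K).geomTorsion ((p : ℕ) : ℤ),
      Continuous fun g : absoluteGaloisGroup K ↦ g • m :=
    continuous_smul_geomTorsion (W.baseChange K) ((p : ℕ) : ℤ)
  have hunrE : ∀ w : HeightOneSpectrum (𝓞 K), w ∉ S₀ → ((p : ℕ) : 𝓞 K) ∉ w.asIdeal →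
      ∀ x ∈ inertia w, ∀ m : (W.baseChange K).geomTorsion ((p : ℕ) : ℤ), x • m = m :=
    fun w hw hpw x hx m ↦ smul_geomTorsion_eq_of_mem_inertia_chosen (W.baseChange K) (hgood w hw hpw) hpw hx m
  have hunrSub : ∀ w : HeightOneSpectrum (𝓞 K), w ∉ S₀ → ((p : ℕ) : 𝓞 K) ∉ w.asIdeal →
      ∀ x ∈ inertia w, ∀ m : S.Sub, x • m = m := fun w hw hpw x hx m ↦
    S.incl_injective (by rw [StableSubgroup.incl_smul]; exact hunrE w hw hpw x hx _)
  have hunrQuot : ∀ w : HeightOneSpectrum (𝓞 K), w ∉ S₀ → ((p : ℕ) : 𝓞 K) ∉ w.asIdeal →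
      ∀ x ∈ inertia w, ∀ m : S.Quot, x • m = m := fun w hw hpw x hx m ↦ by
    obtain ⟨n, rfl⟩ := S.proj_surjective m
    rw [StableSubgroup.smul_proj, hunrE w hw hpw x hx]
  /- Brink: `v̄` is finitely decomposed in `K_∞` -/
  have h𝔭dec : ¬ (decomp vbar ≤ κ.kerSubgroup) :=
    ZpExtension.decomp_not_le_kerSubgroup_above_of_isAnticyclotomic_holds K p hK hp2' κ hκ vbar hvbar
  /- CGLS Prop. 14 for the two characters -/
  have hΦfin : (datumStrictSelmer κ.kerSubgroup S.Sub p (AcSelmer.bdpData S.Sub p vbar) S₀ :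
      Set (Literature.NumberTheory.EllipticCurves.subgroupH1 κ.kerSubgroup S.Sub)).Finite :=
    hfact K p hK hp2' hsplit κ hκ vbar hvbar S.Sub hSub (S.continuous_smul_sub hM) S₀ hS₀fin
      hS₀mem hunrSub hnon1 hωS
  have hΨfin : (datumStrictSelmer κ.kerSubgroup S.Quot p (AcSelmer.bdpData S.Quot p vbar) S₀ :
      Set (Literature.NumberTheory.EllipticCurves.subgroupH1 κ.kerSubgroup S.Quot)).Finite :=
    hfact K p hK hp2' hsplit κ hκ vbar hvbar S.Quot hQuot (S.continuous_smul_quot hM) S₀ hS₀fin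
      hS₀mem hunrQuot hnon2 hωQ
  exact finite_selmerAc_pTorsion_of_line_devissage (W.baseChange K) κ hvbar h𝔭dec hgood S hfix hΦfin hΨfin

/-! ### §3 Torsion and `μ = 0` of `X^{Sf}`: the non-split half of Keller–Yin Lemma 5.1.1 from print -/

/-- **CGLS22 Prop. 14 ⟹ `X^{Sf} = AcSelmer.XAc (E_K) p κ v̄ ↑Sf γ` is `Λ`-torsion with `μ(X^{Sf}) = 0` at every
NON-SPLIT multiplicative Eisenstein datum** — the conclusion of
`KellerYin2024.lemma511_imprimitive_isTorsion_muInvariant_eq_zero_mult_OPEN` at such a datum, now resting on a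
PUBLISHED statement: §2 + Greenberg's criterion (A) (`UniversalToricDescentAcDualMuZero.isTorsion_of_finite_pTorsion`,
`muInvariant_eq_zero_of_finite_pTorsion`). CONDITIONAL on `hfact`; nothing asserted about any curve.
[cite: CastellaGrossiLeeSkinner2022, §1.2 Prop. 14 (arXiv:2008.02571)] [cite: GreenbergLNM1716, §1 p. 60]
[cite: GreenbergVatsal2000, §2 Prop. (2.8)] [cite: KellerYin2024, Lemma 5.1.1 (arXiv:2402.12781v2 §5.1)] -/
theorem isTorsion_muInvariant_eq_zero_of_prop14_of_not_split
    (hfact : prop14_residualCharacterSelmer_finite)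
    {p : ℕ} [Fact p.Prime] (W : WeierstrassCurve ℚ) [W.IsElliptic] [W.IsGloballyMinimal]
    (K : Type) [Field K] [NumberField K] (vbar : HeightOneSpectrum (𝓞 K))
    (κ : ZpExtension K p) (γ : absoluteGaloisGroup K) [Fact (κ.IsTopGenerator γ)]
    (Sf : Finset (HeightOneSpectrum (𝓞 K)))
    (hp2 : 2 < p) (hmult : Mult W p) (hns : ¬ W.HasSplitMultiplicativeReductionAtPrime p)
    (hred : Red W p) (hK : IsImaginaryQuadratic K)
    (hH : SatisfiesHeegnerHypothesis (W.conductorNorm ℤ) K)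
    (hsplit : ((Ideal.span {(p : ℤ)}).primesOver (𝓞 K)).ncard = 2)
    (hvbar : ((p : ℕ) : 𝓞 K) ∈ vbar.asIdeal) (hκ : κ.IsAnticyclotomic)
    (hSf : ∀ w : HeightOneSpectrum (𝓞 K), w ∈ Sf ↔
      (((W.conductorNorm ℤ : ℤ) : 𝓞 K) ∈ w.asIdeal ∧ ((p : ℕ) : 𝓞 K) ∉ w.asIdeal)) :
    Module.IsTorsion (IwasawaAlgebra p)
        (XAc (W.baseChange K) p κ vbar (↑Sf : Set (HeightOneSpectrum (𝓞 K))) γ) ∧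
      muInvariant p (XAc (W.baseChange K) p κ vbar (↑Sf : Set (HeightOneSpectrum (𝓞 K))) γ) = 0 := by
  haveI : (W.baseChange K).IsElliptic := inferInstanceAs (W.map (algebraMap ℚ K)).IsElliptic
  have hS : (↑Sf : Set (HeightOneSpectrum (𝓞 K))).Finite := Finset.finite_toSet Sf
  have hfin := residualFinite_of_prop14_of_not_split hfact W K vbar κ Sf hp2 hmult hns hred hK hH hsplit
    hvbar hκ hSf
  exact ⟨UniversalToricDescentAcDualMuZero.isTorsion_of_finite_pTorsion (W.baseChange K) p κ vbar _ γ hS hfin,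
    UniversalToricDescentAcDualMuZero.muInvariant_eq_zero_of_finite_pTorsion (W.baseChange K) p κ vbar _ γ
      hS hfin⟩

/-- **The NON-SPLIT HALF of Keller–Yin Lemma 5.1.1 (member `f`), FROM PRINT.** The statement of the named
preprint fact `KellerYin2024.lemma511_imprimitive_isTorsion_muInvariant_eq_zero_mult_OPEN` with its binders
VERBATIM plus ONE extra binder `¬ W.HasSplitMultiplicativeReductionAtPrime p`, derived from the published
`CastellaGrossiLeeSkinner2022.prop14_residualCharacterSelmer_finite`. (The binders `Odd d_K`, `d_K ≠ −3` are
carried unused, as in the fact.) CONDITIONAL on `hfact`; at a SPLIT multiplicative prime nothing is claimed.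
[cite: CastellaGrossiLeeSkinner2022, §1.2 Prop. 14, §1.4 Props. 17–18 (arXiv:2008.02571; Invent. Math. 227 (2022))]
[cite: KellerYin2024, Lemma 5.1.1 (arXiv:2402.12781v2 §5.1 TeX L1744–1749)] -/
theorem lemma511Nonsplit_of_prop14 (hfact : prop14_residualCharacterSelmer_finite) :
    ∀ {p : ℕ} [Fact p.Prime] (W : WeierstrassCurve ℚ) [W.IsElliptic] [W.IsGloballyMinimal]
      (K : Type) [Field K] [NumberField K] (vbar : HeightOneSpectrum (𝓞 K))
      (κ : ZpExtension K p) (γ : absoluteGaloisGroup K) [Fact (κ.IsTopGenerator γ)]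
      (Sf : Finset (HeightOneSpectrum (𝓞 K))),
      2 < p → Mult W p → ¬ W.HasSplitMultiplicativeReductionAtPrime p → Red W p →
      IsImaginaryQuadratic K → SatisfiesHeegnerHypothesis (W.conductorNorm ℤ) K →
        Odd (NumberField.discr K) → NumberField.discr K ≠ -3 →
        ((Ideal.span {(p : ℤ)}).primesOver (𝓞 K)).ncard = 2 →
      ((p : ℕ) : 𝓞 K) ∈ vbar.asIdeal → κ.IsAnticyclotomic →
      (∀ w : HeightOneSpectrum (𝓞 K), w ∈ Sf ↔
        (((W.conductorNorm ℤ : ℤ) : 𝓞 K) ∈ w.asIdeal ∧ ((p : ℕ) : 𝓞 K) ∉ w.asIdeal)) →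
      Module.IsTorsion (IwasawaAlgebra p)
          (XAc (W.baseChange K) p κ vbar (↑Sf : Set (HeightOneSpectrum (𝓞 K))) γ) ∧
        muInvariant p (XAc (W.baseChange K) p κ vbar (↑Sf : Set (HeightOneSpectrum (𝓞 K))) γ) = 0 :=
  fun W _ _ K _ _ vbar κ γ _ Sf hp hmult hns hred hK hH _ _ hsplit hvbar hκ hSf ↦
    isTorsion_muInvariant_eq_zero_of_prop14_of_not_split hfact W K vbar κ γ Sf hp hmult hns hred hK hH
      hsplit hvbar hκ hSf

end Summit.BirchSwinnertonDyer.BirchSwinnertonDyer.Theorems.KellerYinLemma511NonsplitOfPrint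

end
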